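import Literature.Probability.Percolation.WernerCorrelationLengthProofs
import HarnessLib

/-!
# `θ(p) ≥ c · P_p(0 ↔ ∂Λ_{L_ε(p)})` for every `ε ∈ (0, 1/2)`: reduction to the equivalence of lengths

Topic `Literature/Probability/Percolation`; family `crit-perc`. Proof-only sibling of
`NearCriticalScaling.lean` for its named fact `Nolin2008_cor41` (Nolin 2008, §7.4, Cor. 41
[arXiv 0711.4948: Cor. 39]: `θ(p) ≍ P_p(0 ⇝ ∂S_{L_ε(p)})` uniformly in `p > 1/2`, for every fixed
`ε ∈ (0, 1/2)`), no new definition and no new named fact.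

## State of the discharge of `Nolin2008_cor41`

Nolin's proof of Cor. 41 (ladder of overlapping parallelograms crossed the hard way with
probabilities `1 - C₁ e^{-C₂ 2^k}`, Harris–FKG) is PROVED in the tree for an abstract base scale
(`Nolin2008_cor41_at_of_ladder`, `NearCriticalArm.lean`; `le_triTheta_of_decay`,
`WernerCorrelationLengthProofs.lean`), as are RSW at `p = 1/2` (`tri_rsw_half_holds`) and the
finiteness of `L_ε` (`Nolin2008_subcritical_crossing_holds`). What it consumes is the uniform
exponential decay of easy-way crossings above `L_ε(p)` (Nolin's Lemma 39 with Remark 40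
[arXiv: Lemma 37, Remark 38], the tree's named fact `Nolin2008_lemma39`), whose printed proof has
two inputs that are NOT theorems of the tree:

* the start of the block iteration, "`P_p(𝒞_H([0, L(p)] × [0, 2L(p)])) ≤ ε₁` for `ε ≤ ε₀`" — the
  near-`1` clause of the Russo–Seymour–Welsh theorem at general `p` (named fact
  `Nolin2008_RSW_one`, `NearCriticalCorrelationLengthLower.lean`), from which the tree proves
  Lemma 39 for `ε ≤ ε₀` (`Nolin2008_lemma39_small`, `NearCriticalRSW.lean`);
* the passage to every `ε ∈ (0, 1/2)`: "The result for any `ε ∈ (0, 1/2)` follows readily by using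
  the equivalence of lengths for different values of `ε` (Corollary 37 [arXiv: Cor. 35])",
  `L_ε(p) ≍ L_{ε'}(p)`, whose printed proof uses Kesten's relation `|p - 1/2| L² π₄(L) ≍ 1` at both
  `ε` and `ε'` (Prop. 34, named fact `Nolin2008_prop34`), quasi-multiplicativity of the four-arm
  probability and the a-priori bound `π₄(n, N) ≥ C (n/N)^{2-α'}` from five arms (Nolin, proof of
  Cor. 37; "this exponential decay property … would for instance provide a more direct way to prove
  that `L_ε ≍ L_{ε'}`, but still only for `ε, ε'` less than some fixed value").

This file PROVES the second step ("follows readily") and assembles the reductions, so that the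
discharge `Nolin2008_cor41_holds` is exactly: `Nolin2008_RSW_one` + the non-trivial inequality of
Cor. 37 near `p = 1/2` (hypothesis `hlen` below, stated inline; the trivial inequality
`L_{ε'} ≤ L_ε` for `ε ≤ ε'` is `charLength_anti`). Equivalently (second form), the single
inequality `L(p, η) ≤ C(ε) · L_ε(p)` between Werner's easy-way length `charLengthW η`
(`η ≤ 1/(100 e)`, for which the decay above `L(p, η)` and Cor. 41 at `L(p, η)` are theorems:
`triLRCrossingProb_long_exp_le_charLengthW`, `le_triTheta_charLengthW`) and Nolin's rhombus length.

## Contents (all proved)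

* `charLength_le_mul_charLength_of_near` — a comparison `L_{ε₀}(p) ≤ C L_ε(p)` valid for `p`
  just below `1/2` extends to all `p ∈ (ε, 1/2)` (monotonicity of `L_{ε₀}` in `p`,
  `charLength_le_charLength`, and `L_ε ≥ 1` there).
* `Nolin2008_lemma39_of_small_of_lengths` — Nolin's "follows readily": Lemma 39 with Remark 40
  for every `ε ∈ (0, 1/2)` from its instances at `ε ≤ ε₀` and the comparisons
  `L_{ε₀} ≤ C(ε) L_ε` near `1/2` (`e^{-C₂ n / L_{ε₀}} ≤ e^{-(C₂/C) n / L_ε}`).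
* `Nolin2008_lemma39_of_RSW_one_of_lengths`, `Nolin2008_cor41_of_RSW_one_of_lengths` — the named
  facts `Nolin2008_lemma39` and `Nolin2008_cor41` from `Nolin2008_RSW_one` and the comparisons of
  lengths (with `Nolin2008_lemma39_small`, `Nolin2008_cor41_of_ladder`, `tri_rsw_half_holds`,
  `Nolin2008_subcritical_crossing_holds`).
* `Nolin2008_cor41_at_of_RSW_one` — for the record, Cor. 41 at every `ε ≤ ε₀` from
  `Nolin2008_RSW_one` alone (the instance the assembly `triTheta_exponent_of_leaves5` consumes).
* `Nolin2008_cor41_of_charLengthW_le` — `Nolin2008_cor41` from the single comparison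
  `charLengthW η p ≤ C(ε) · charLength ε p` near `1/2` (Werner's route: `le_triTheta_of_decay`,
  `triLRCrossingProb_long_exp_le_charLengthW`), no RSW hypothesis.

## References

* P. Nolin, Near-critical percolation in two dimensions, *Electron. J. Probab.* 13 (2008)
  1562–1623, §7.3 Cor. 37 with its proof and the Remark after Lemma 39; §7.4 Lemma 39, Remark 40,
  Cor. 41 (arXiv 0711.4948: Cor. 35, Lemma 37, Remark 38, Cor. 39) [Nolin2008].
* W. Werner, Lectures on two-dimensional critical percolation, PCMI (2009), Lecture 6, §1
  [WernerPCMI2009].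
* H. Kesten, Scaling relations for 2D-percolation, *Comm. Math. Phys.* 109 (1987) [KestenScalingCMP1987].

Tree: `charLength`, `charLength_symm` (`KestenScaling.lean`), `charLength_le_charLength`,
`le_charLength_eventually` (`KestenRelationRusso.lean`), `BollobasRiordan2006_ch5_lemma7_holds`
(`KestenRelationRussoProofs.lean`), `Nolin2008_lemma39`, `Nolin2008_cor41_at_of_ladder`,
`Nolin2008_cor41_of_ladder` (`NearCriticalArm.lean`), `one_le_charLength`,
`Nolin2008_lemma39_small`, `Nolin2008_subcritical_crossing_holds` (`NearCriticalRSW.lean`),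
`tri_rsw_half_holds` (`TriThetaHalf.lean`), `charLengthW`, `one_le_charLengthW`,
`triLRCrossingProb_long_exp_le_charLengthW`, `le_triTheta_of_decay`
(`WernerCorrelationLength(Proofs).lean`). Mathlib: `Real.exp` only.
-/

noncomputable section

open MeasureTheory Set Filter Topology
open scoped unitInterval

namespace Literature.Probability.Percolation

open LatticeModels

/-! ### From a comparison of lengths near `1/2` to a comparison on `(ε, 1/2)` -/

/-- **A comparison of lengths near `1/2` is a comparison everywhere.** If `0 < ε₀ ≤ ε` and
`L_{ε₀}(p) ≤ C · L_ε(p)` for `1/2 - δ < p < 1/2`, then `L_{ε₀}(p) ≤ K · L_ε(p)` for all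
`ε < p < 1/2` with a constant `K > 0`: below `1/2 - δ` the length `L_{ε₀}(p)` is bounded by its
value at `1/2 - min(δ, 1)/2` (`L_{ε₀}` is non-decreasing in `p`, `charLength_le_charLength`), while
`L_ε(p) ≥ 1` for `p > ε` (`one_le_charLength`). (Nolin's `≍` of Cor. 37 is uniform in `p`; only
its behaviour as `p → 1/2` carries content.) [cite: Nolin2008, §7.3, Cor. 37 (arXiv 0711.4948: Cor. 35)] -/
theorem charLength_le_mul_charLength_of_near {ε₀ ε δ C : ℝ} (hε₀ : 0 < ε₀) (hε₀ε : ε₀ ≤ ε)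
    (hδ : 0 < δ)
    (hC : ∀ p : unitInterval, 1 / 2 - δ < (p : ℝ) → (p : ℝ) < 1 / 2 →
      (charLength ε₀ p : ℝ) ≤ C * charLength ε p) :
    ∃ K > (0 : ℝ), ∀ p : unitInterval, ε < (p : ℝ) → (p : ℝ) < 1 / 2 →
      (charLength ε₀ p : ℝ) ≤ K * charLength ε p := by
  have hsub := Nolin2008_subcritical_crossing_holds
  have hε : 0 < ε := hε₀.trans_le hε₀ε
  -- the reference point `t₀ = 1/2 - min(δ, 1)/2 ∈ [0, 1/2)`
  set δ₁ : ℝ := min δ 1 with hδ₁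
  have hδ₁0 : 0 < δ₁ := lt_min hδ one_pos
  have hδ₁δ : δ₁ ≤ δ := min_le_left _ _
  have hδ₁1 : δ₁ ≤ 1 := min_le_right _ _
  set t₀ : unitInterval := ⟨1 / 2 - δ₁ / 2, by constructor <;> linarith⟩ with ht₀
  have ht₀v : ((t₀ : unitInterval) : ℝ) = 1 / 2 - δ₁ / 2 := rfl
  have ht₀h : ((t₀ : unitInterval) : ℝ) < 1 / 2 := by rw [ht₀v]; linarith
  set Λ : ℕ := charLength ε₀ t₀ with hΛ
  refine ⟨max C 1 * ((Λ : ℝ) + 1), by positivity, fun p hεp hp => ?_⟩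
  have hL1 : (1 : ℝ) ≤ charLength ε p := by exact_mod_cast one_le_charLength hsub hε hεp hp
  have hL0 : (0 : ℝ) ≤ charLength ε p := by linarith
  rcases lt_or_ge (1 / 2 - δ) (p : ℝ) with hnear | hfar
  · -- near `1/2`: the hypothesis, then `C ≤ max C 1 ≤ max C 1 * (Λ + 1)`
    calc (charLength ε₀ p : ℝ) ≤ C * charLength ε p := hC p hnear hp
      _ ≤ max C 1 * charLength ε p := mul_le_mul_of_nonneg_right (le_max_left _ _) hL0
      _ ≤ max C 1 * ((Λ : ℝ) + 1) * charLength ε p := by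
          apply mul_le_mul_of_nonneg_right _ hL0
          have h1 : (0 : ℝ) ≤ max C 1 := le_trans zero_le_one (le_max_right _ _)
          have h2 : (1 : ℝ) ≤ (Λ : ℝ) + 1 := by
            have : (0 : ℝ) ≤ Λ := Nat.cast_nonneg _
            linarith
          nlinarith
  · -- far from `1/2`: `L_{ε₀}(p) ≤ L_{ε₀}(t₀) = Λ ≤ (Λ + 1) · L_ε(p)`
    have hpt : p ≤ t₀ := Subtype.coe_le_coe.1 (by rw [ht₀v]; linarith)
    have hmono : charLength ε₀ p ≤ Λ := charLength_le_charLength hsub hε₀ hpt ht₀h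
    have hmono' : (charLength ε₀ p : ℝ) ≤ Λ := by exact_mod_cast hmono
    calc (charLength ε₀ p : ℝ) ≤ (Λ : ℝ) + 1 := by linarith
      _ ≤ ((Λ : ℝ) + 1) * charLength ε p := by
          have h0 : (0 : ℝ) ≤ (Λ : ℝ) + 1 := by positivity
          nlinarith
      _ ≤ max C 1 * ((Λ : ℝ) + 1) * charLength ε p := by
          rw [mul_assoc]
          have h0 : (0 : ℝ) ≤ ((Λ : ℝ) + 1) * charLength ε p := by positivity
          nlinarith [le_max_right C 1]

/-! ### Nolin's Lemma 39 for every `ε` from small `ε` and the equivalence of lengths -/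

/-- **Lemma 39 for every `ε ∈ (0, 1/2)` from small `ε`** (Nolin 2008, proof of Lemma 39, last
paragraph: "Hence, we have proved the property for any `ε` below some fixed value `ε₀` (given by
RSW). The result for any `ε ∈ (0, 1/2)` follows readily by using the equivalence of lengths for
different values of `ε` (Corollary 37)"). Given the decay of easy-way crossings above `L_ε` for all
`ε ≤ ε₀` (the conclusion of `Nolin2008_lemma39_small`) and, for every `ε ∈ (ε₀, 1/2)`, the
comparison `L_{ε₀}(p) ≤ C L_ε(p)` for `p` just below `1/2` (Cor. 37), the named fact
`Nolin2008_lemma39` holds: for `ε < p < 1/2`,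
`P_p(LR(n, k n)) ≤ C₁ e^{-C₂ n / L_{ε₀}(p)} ≤ C₁ e^{-(C₂/K) n / L_ε(p)}` with the `K` of
`charLength_le_mul_charLength_of_near`. [cite: Nolin2008, §7.4, Lemma 39 and Remark 40, with §7.3 Cor. 37 (arXiv 0711.4948: Lemma 37, Remark 38, Cor. 35)] -/
theorem Nolin2008_lemma39_of_small_of_lengths {ε₀ : ℝ} (hε₀ : 0 < ε₀)
    (hsmall : ∀ ⦃ε : ℝ⦄, 0 < ε → ε ≤ ε₀ → ∀ k : ℕ, 1 ≤ k →
      ∃ C₁ > (0 : ℝ), ∃ C₂ > (0 : ℝ), ∀ p : unitInterval, ε < (p : ℝ) → (p : ℝ) < 1 / 2 →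
        ∀ n : ℕ, 1 ≤ n →
          triLRCrossingProb p n (k * n) ≤ C₁ * Real.exp (-(C₂ * n / charLength ε p)))
    (hlen : ∀ ⦃ε : ℝ⦄, ε₀ < ε → ε < 1 / 2 →
      ∃ δ > (0 : ℝ), ∃ C : ℝ, ∀ p : unitInterval, 1 / 2 - δ < (p : ℝ) → (p : ℝ) < 1 / 2 →
        (charLength ε₀ p : ℝ) ≤ C * charLength ε p) :
    Nolin2008_lemma39 := by
  intro ε hε hε' k hk
  rcases le_or_gt ε ε₀ with hle | hgt
  · exact hsmall hε hle k hk
  · obtain ⟨C₁, hC₁, C₂, hC₂, hb⟩ := hsmall hε₀ le_rfl k hk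
    obtain ⟨δ, hδ, C, hC⟩ := hlen hgt hε'
    obtain ⟨K, hK, hKb⟩ := charLength_le_mul_charLength_of_near hε₀ hgt.le hδ hC
    refine ⟨C₁, hC₁, C₂ / K, div_pos hC₂ hK, fun p hεp hp n hn => ?_⟩
    have hε₀p : ε₀ < (p : ℝ) := hgt.trans hεp
    have hL₀ : (0 : ℝ) < charLength ε₀ p := by
      have := one_le_charLength Nolin2008_subcritical_crossing_holds hε₀ hε₀p hp
      exact_mod_cast Nat.lt_of_lt_of_le Nat.zero_lt_one this
    refine (hb p hε₀p hp n hn).trans (mul_le_mul_of_nonneg_left ?_ hC₁.le)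
    apply Real.exp_le_exp.2
    apply neg_le_neg
    have hcmp := hKb p hεp hp
    have hnum : (0 : ℝ) ≤ C₂ * n := by positivity
    calc C₂ / K * n / charLength ε p = C₂ * n / (K * charLength ε p) := by
          field_simp
      _ ≤ C₂ * n / charLength ε₀ p := div_le_div_of_nonneg_left hnum hL₀ hcmp

/-- **`Nolin2008_lemma39` from RSW near `1` and the equivalence of lengths**: the uniform
exponential decay above `L_ε(p)` for every `ε ∈ (0, 1/2)` (Nolin 2008, Lemma 39 with Remark 40)
follows from the "moreover" clause of the RSW theorem at general `p` (`Nolin2008_RSW_one`, through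
`Nolin2008_lemma39_small`) and the non-trivial inequality of Cor. 37, `L_{ε₀}(p) ≤ C L_ε(p)` for
`ε₀ < ε` and `p` just below `1/2`. [cite: Nolin2008, §7.4, Lemma 39 and Remark 40 (arXiv 0711.4948: Lemma 37, Remark 38)] -/
theorem Nolin2008_lemma39_of_RSW_one_of_lengths (hone : Nolin2008_RSW_one)
    (hlen : ∀ ⦃ε₀ ε : ℝ⦄, 0 < ε₀ → ε₀ < ε → ε < 1 / 2 →
      ∃ δ > (0 : ℝ), ∃ C : ℝ, ∀ p : unitInterval, 1 / 2 - δ < (p : ℝ) → (p : ℝ) < 1 / 2 →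
        (charLength ε₀ p : ℝ) ≤ C * charLength ε p) :
    Nolin2008_lemma39 := by
  obtain ⟨ε₀, hε₀, hsmall⟩ := Nolin2008_lemma39_small hone Nolin2008_subcritical_crossing_holds
  exact Nolin2008_lemma39_of_small_of_lengths hε₀ hsmall fun ε h h' => hlen hε₀ h h'

/-- **Cor. 41 from RSW near `1` and the equivalence of lengths** (Nolin 2008, §7.4, Cor. 41
[arXiv 0711.4948: Cor. 39], for every `ε ∈ (0, 1/2)`): the named fact `Nolin2008_cor41` follows
from `Nolin2008_RSW_one` and the non-trivial inequality `L_{ε₀}(p) ≤ C L_ε(p)` (`0 < ε₀ < ε < 1/2`,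
`p` just below `1/2`) of Cor. 37 — everything else (RSW at `1/2`, the ladder and Harris–FKG, the
block argument, the finiteness and divergence of `L_ε`) being theorems of the tree
(`Nolin2008_cor41_of_ladder`, `tri_rsw_half_holds`, `Nolin2008_subcritical_crossing_holds`). [cite: Nolin2008, §7.4, Cor. 41 (arXiv 0711.4948: Cor. 39)] -/
theorem Nolin2008_cor41_of_RSW_one_of_lengths (hone : Nolin2008_RSW_one)
    (hlen : ∀ ⦃ε₀ ε : ℝ⦄, 0 < ε₀ → ε₀ < ε → ε < 1 / 2 →
      ∃ δ > (0 : ℝ), ∃ C : ℝ, ∀ p : unitInterval, 1 / 2 - δ < (p : ℝ) → (p : ℝ) < 1 / 2 →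
        (charLength ε₀ p : ℝ) ≤ C * charLength ε p) :
    Nolin2008_cor41 :=
  Nolin2008_cor41_of_ladder tri_rsw_half_holds (Nolin2008_lemma39_of_RSW_one_of_lengths hone hlen)
    Nolin2008_subcritical_crossing_holds

/-- **Cor. 41 at every small `ε`, from RSW near `1` alone** (Nolin 2008, §7.4, Cor. 41
[arXiv 0711.4948: Cor. 39], at the `ε ≤ ε₀` "given by RSW" of the proof of Lemma 39): there is
`ε₀ > 0` such that for every `0 < ε ≤ ε₀`, `ε < 1/2`, there are `δ, c > 0` with
`c · P_p(0 ↔ ∂Λ_{L_ε(p)}) ≤ θ(p)` for `1/2 < p < 1/2 + δ` (`Nolin2008_lemma39_small` for the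
aspect ratios `4` and `2`, then `Nolin2008_cor41_at_of_ladder`). This is the instance consumed by
`triTheta_exponent_of_leaves5`. [cite: Nolin2008, §7.4, Cor. 41 (arXiv 0711.4948: Cor. 39)] -/
theorem Nolin2008_cor41_at_of_RSW_one (hone : Nolin2008_RSW_one) :
    ∃ ε₀ > (0 : ℝ), ∀ ⦃ε : ℝ⦄, 0 < ε → ε ≤ ε₀ → ε < 1 / 2 →
      ∃ δ > (0 : ℝ), ∃ c > (0 : ℝ),
        ∀ p : unitInterval, 1 / 2 < (p : ℝ) → (p : ℝ) < 1 / 2 + δ →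
          c * (triSitePercolation p).real (triOneArm (charLength ε p)) ≤ triTheta p := by
  have hsub := Nolin2008_subcritical_crossing_holds
  obtain ⟨ε₀, hε₀, h39⟩ := Nolin2008_lemma39_small hone hsub
  refine ⟨ε₀, hε₀, fun ε hε hεle hε' => ?_⟩
  exact Nolin2008_cor41_at_of_ladder hε hε' tri_rsw_half_holds (h39 hε hεle 4 (by norm_num))
    (h39 hε hεle 2 (by norm_num)) hsub

/-! ### The same through Werner's easy-way length -/

/-- **Cor. 41 from one comparison of lengths** (Nolin 2008, §7.4, Cor. 41 [arXiv 0711.4948: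
Cor. 39]; Werner 2009, Lecture 6, §1). Fix `0 < η ≤ 1/(100 e)`. If for every `ε ∈ (0, 1/2)`
Werner's easy-way length is at most a constant multiple of Nolin's rhombus length just below `1/2`,
`L(p, η) ≤ C(ε) · L_ε(p)` for `1/2 - δ < p < 1/2` (`charLengthW`, `charLength`; for `ε ≤ ε₀` this is
the near-`1` RSW statement Werner's definition avoids, for larger `ε` it also contains Nolin's
Cor. 37), then `Nolin2008_cor41` holds: the closed easy-way crossings decay above `L(1 - p, η)`
(`triLRCrossingProb_long_exp_le_charLengthW`, a theorem), hence above `L_ε(p)/C`, and the ladder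
at base scale `L_ε(p) ≥ 8` applies (`le_triTheta_of_decay`, `le_charLength_eventually`). No RSW
hypothesis beyond `p = 1/2`. [cite: Nolin2008, §7.4, Cor. 41 (arXiv 0711.4948: Cor. 39)] [cite: WernerPCMI2009, Lecture 6, §1 (last display)] -/
theorem Nolin2008_cor41_of_charLengthW_le {η : ℝ} (hη : 0 < η) (hη' : η ≤ 1 / (100 * Real.exp 1))
    (hlen : ∀ ⦃ε : ℝ⦄, 0 < ε → ε < 1 / 2 →
      ∃ δ > (0 : ℝ), ∃ C : ℝ, ∀ p : unitInterval, 1 / 2 - δ < (p : ℝ) → (p : ℝ) < 1 / 2 →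
        (charLengthW η p : ℝ) ≤ C * charLength ε p) :
    Nolin2008_cor41 := by
  intro ε hε hε'
  have hsub := Nolin2008_subcritical_crossing_holds
  obtain ⟨δ, hδ, C, hC⟩ := hlen hε hε'
  set C' : ℝ := max C 1 with hC'
  have hC'0 : 0 < C' := lt_of_lt_of_le one_pos (le_max_right _ _)
  -- decay constants above `L_ε(p)`: `C₁ = 4k e^{1/4}`, `C₂ = 1/(8 C')`, `k = 4, 2`
  have hA4 : (0 : ℝ) < 4 * (4 : ℕ) * Real.exp (1 / 4) := by positivity
  have hA2 : (0 : ℝ) < 4 * (2 : ℕ) * Real.exp (1 / 4) := by positivity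
  have hB : (0 : ℝ) < 1 / (8 * C') := by positivity
  obtain ⟨c, hc, hlad⟩ := le_triTheta_of_decay tri_rsw_half_holds hA4 hB hA2 hB
  obtain ⟨δL, hδL, hL⟩ :=
    le_charLength_eventually BollobasRiordan2006_ch5_lemma7_holds hsub hε hε' 8
  refine ⟨min δ δL, lt_min hδ hδL, c, hc, fun p hp1 hp2 => ?_⟩
  have hδ1 := min_le_left δ δL
  have hδ2 := min_le_right δ δL
  -- the dual parameter `1 - p ∈ (1/2 - min δ δL, 1/2)`
  have hσ : ((σ p : unitInterval) : ℝ) = 1 - p := unitInterval.coe_symm_eq p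
  have hσ2 : ((σ p : unitInterval) : ℝ) < 1 / 2 := by rw [hσ]; linarith
  have hσδ : 1 / 2 - δ < ((σ p : unitInterval) : ℝ) := by rw [hσ]; linarith
  have hσδL : 1 / 2 - δL < ((σ p : unitInterval) : ℝ) := by rw [hσ]; linarith
  have hp : half ≤ p := Subtype.coe_le_coe.1 (by rw [coe_half]; linarith)
  -- the base scale `M = L_ε(p) = L_ε(1 - p) ≥ 8` and the comparison `L(1 - p, η) ≤ C' M`
  set M := charLength ε p with hM
  have hM8 : 8 ≤ M := by rw [hM, ← charLength_symm]; exact hL (σ p) hσδL hσ2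
  have hMpos : (0 : ℝ) < M := by exact_mod_cast (show 0 < M by omega)
  have hW1 : 1 ≤ charLengthW η (σ p) := one_le_charLengthW hη hσ2.ne
  have hWpos : (0 : ℝ) < charLengthW η (σ p) := by exact_mod_cast hW1
  have hcmp : (charLengthW η (σ p) : ℝ) ≤ C' * M := by
    have h := hC (σ p) hσδ hσ2
    rw [charLength_symm] at h
    exact h.trans (mul_le_mul_of_nonneg_right (le_max_left _ _) hMpos.le)
  -- the exponent comparison
  have hexp : ∀ n : ℕ, Real.exp (-((n : ℝ) / (8 * charLengthW η (σ p)))) ≤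
      Real.exp (-(1 / (8 * C') * n / M)) := by
    intro n
    apply Real.exp_le_exp.2
    apply neg_le_neg
    have hn0 : (0 : ℝ) ≤ n := Nat.cast_nonneg n
    calc 1 / (8 * C') * (n : ℝ) / M = n / (8 * (C' * M)) := by
          field_simp
      _ ≤ n / (8 * charLengthW η (σ p)) :=
          div_le_div_of_nonneg_left hn0 (by positivity) (by nlinarith [hcmp])
  refine hlad p hp M hM8 (fun n hn => ?_) (fun n hn => ?_)
  · have h := triLRCrossingProb_long_exp_le_charLengthW hη hη' hσ2 (k := 4) (by norm_num) hn
    exact h.trans (mul_le_mul_of_nonneg_left (hexp n) hA4.le)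
  · have h := triLRCrossingProb_long_exp_le_charLengthW hη hη' hσ2 (k := 2) (by norm_num) hn
    exact h.trans (mul_le_mul_of_nonneg_left (hexp n) hA2.le)

end Literature.Probability.Percolation
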